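import Literature.Probability.Percolation.FiniteClustersPercolationOneArm
import Literature.Probability.Percolation.OneArmLSW
import Literature.Probability.Percolation.PlanarDuality
import HarnessLib

/-!
# Gluing step of the planar-armed-sections renormalisation: coarse percolation ⟹ `X` percolates

Crux `VacantSetPercolates` (item stmt-CriticalPhenomena-7205), line `planar-armed-sections`, stub
`stub_coarseToVacant`.  Given the square-crossing certificate of an open coarse edge (the statement of
the neighbouring stub `stub_squareCrossings`, taken as a hypothesis), an infinite open cluster of the
coarse origin in the renormalised bond process on `ℤ²` yields infinitely many planar-quiet sites all
joined to one base point by lattice paths of planar-quiet sites; embedding the coordinate plane into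
`ℤ³` (`planeEmb 3`) and using that quiet sites have finite clusters
(`reachable_finiteClusters_of_pathIn`) this is an infinite connected set of GHK's graph
`X = ℤ³[{C finite}]`, i.e. `ω ∈ finiteClustersPercolate (zdGraph 3)`.

The argument: along a coarse path from `0`, consecutive open coarse edges share a coarse vertex `u`,
in whose `N`-square a left-right and a bottom-top quiet crossing MEET
(`exists_mem_support_of_crossing`), so all certified crossings are joined to one base point; a planar
site lies in finitely many `N`-squares (`N ≥ 1`), so infinitely many coarse vertices give infinitely
many joined planar sites.

References: G. R. Grimmett, A. E. Holroyd, G. Kozma, *Percolation of finite clusters and infinite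
surfaces*, Math. Proc. Cambridge Philos. Soc. 156 (2014), §4 (proof of Thm. 5, block argument);
G. Grimmett, *Percolation* (1999), §1.4 (the embedding `𝕃² ↪ 𝕃^d`).
-/

noncomputable section

namespace Summit.CriticalPhenomena.PercolationContinuityZ3.Theorems

open MeasureTheory Set Literature.Probability.Percolation Literature.Probability.LatticeModels

namespace CoarseToVacant

/-- **Meet lemma.** Inside a set `A` contained in the box `[L, R] × [B, T]`, the start of a
left-right crossing and the start of a bottom-top crossing are joined inside `A` (the two lattice
walks share a vertex, `exists_mem_support_of_crossing`). [folklore] -/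
theorem pathIn_of_crossings {A : Set (Site 2)} {x y x' y' : Site 2}
    (hP : PathIn (zdGraph 2) A x y) (hQ : PathIn (zdGraph 2) A x' y') {L R B T : ℤ}
    (hx : x 0 = L) (hy : y 0 = R) (hx' : x' 1 = B) (hy' : y' 1 = T)
    (hA : ∀ w ∈ A, L ≤ w 0 ∧ w 0 ≤ R ∧ B ≤ w 1 ∧ w 1 ≤ T) :
    PathIn (zdGraph 2) A x x' := by
  classical
  obtain ⟨P, hPs⟩ := hP.exists_walk
  obtain ⟨Q, hQs⟩ := hQ.exists_walk
  obtain ⟨m, hmP, hmQ⟩ := exists_mem_support_of_crossing P Q (fun z hz => hA z (hPs z hz))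
    (fun z hz => hA z (hQs z hz)) hx hy hx' hy'
  exact (PathIn.of_walk_mem_support P hPs hmP).1.trans (PathIn.of_walk_mem_support Q hQs hmQ).1.symm

/-- **Induction along coarse paths.** Abstract gluing: if every coarse edge `u ∼ v` certifies
crossings of both squares in both directions joined to a common point (`hedge`), a `0`-crossing and
a `1`-crossing of the same square have joined base points (`hmeet`), and certificates can be re-based
along paths (`htrans`), then every coarse vertex reachable from `o` has crossings in both directions
joined to any base point of `o`. [cite: GrimmettHolroydKozma2014, §4 (proof of Thm. 5, block argument)] -/
theorem cross_of_reachable {V W : Type*} {G₂ : SimpleGraph V} {G : SimpleGraph W} {S : Set W}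
    {Cross : V → Fin 2 → W → Prop}
    (hmeet : ∀ u z z', Cross u 0 z → Cross u 1 z' → PathIn G S z z')
    (htrans : ∀ v i z z', PathIn G S z z' → Cross v i z' → Cross v i z)
    (hedge : ∀ u v, G₂.Adj u v → ∃ z, (∀ i, Cross u i z) ∧ ∀ i, Cross v i z)
    {o : V} {z₀ : W} (h0 : ∀ i, Cross o i z₀) {v : V} (hv : G₂.Reachable o v) :
    ∀ i, Cross v i z₀ := by
  rw [SimpleGraph.reachable_iff_reflTransGen] at hv
  induction hv with
  | refl => exact h0
  | @tail b c _ hbc ih =>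
    obtain ⟨z, hzb, hzc⟩ := hedge b c hbc
    have hpath : PathIn G S z₀ z := hmeet b z₀ z (ih 0) (hzb 1)
    exact fun i => htrans c i z₀ z hpath (hzc i)

/-- **Finite-to-one.** A planar site `x` lies in the `N`-square `{N v_l ≤ w_l ≤ N v_l + N}` of only
finitely many coarse sites `v` (`N ≥ 1`). [folklore] -/
theorem finite_fibre {N : ℕ} (hN : 1 ≤ N) (x : Site 2) :
    {v : Site 2 | ∀ l : Fin 2, (N : ℤ) * v l ≤ x l ∧ x l ≤ (N : ℤ) * v l + (N : ℤ)}.Finite := by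
  have hN' : (0 : ℤ) < N := by exact_mod_cast hN
  refine (Set.finite_Icc (fun l => x l / N - 1) (fun l => x l / N)).subset fun v hv => ?_
  refine ⟨fun l => ?_, fun l => ?_⟩
  · have h := (hv l).2
    have : x l / N ≤ v l + 1 := Int.ediv_le_of_le_mul hN' (by linarith)
    show x l / N - 1 ≤ v l
    linarith
  · have h := (hv l).1
    show v l ≤ x l / N
    exact Int.le_ediv_of_mul_le hN' (by linarith)

/-- **Gluing, abstract form.** For a coarse bond configuration on `ℤ²` whose open edges
`{a, a + e_k}` all carry a certificate (`hSq`: quiet crossings of the `N`-squares of both endpoints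
in both directions, joined through planar-quiet sites to one point), an infinite open cluster of the
coarse origin forces an infinite connected set of GHK's graph `X` in `ℤ³` (`ω ⊆ E(ℤ³)`, `N ≥ 1`).
[cite: GrimmettHolroydKozma2014, §4 (proof of Thm. 5, "there exists an infinite component in Γ")] -/
theorem mem_finiteClustersPercolate_of_coarse {n N : ℕ} {ω : BondConfig (Site 3)}
    {G₁ G₂ : Site 2 → Fin 2 → Prop}
    (hSq : ∀ (a : Site 2) (k : Fin 2), 1 ≤ N → G₁ a k → G₂ a k →
      ∃ z : Site 2, ∀ v : Site 2, (v = a ∨ v = a + Pi.single k 1) → ∀ i : Fin 2,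
        ∃ x y : Site 2, x i = (N : ℤ) * v i ∧ y i = (N : ℤ) * v i + (N : ℤ) ∧
          PathIn (zdGraph 2) ({w : Site 2 | ∀ l : Fin 2, (N : ℤ) * v l ≤ w l ∧ w l ≤ (N : ℤ) * v l + (N : ℤ)} ∩
            {w | planeEmb 3 w ∈ quietSet n ω}) x y ∧
          PathIn (zdGraph 2) {w | planeEmb 3 w ∈ quietSet n ω} z x)
    (hN : 1 ≤ N) (hω : ω ⊆ (zdGraph 3).edgeSet)
    (hinf : (openCluster {e : Sym2 (Site 2) | ∃ (a : Site 2) (k : Fin 2),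
      e = s(a, a + Pi.single k 1) ∧ G₁ a k ∧ G₂ a k} (0 : Site 2)).Infinite) :
    ω ∈ finiteClustersPercolate (zdGraph 3) := by
  set S : Set (Site 2) := {w | planeEmb 3 w ∈ quietSet n ω} with hS
  -- the certificate "`Q(v)` has a quiet `i`-crossing whose start is joined to `z` through `S`"
  obtain ⟨Cross, hCross⟩ : ∃ Cross : Site 2 → Fin 2 → Site 2 → Prop, ∀ v i z, Cross v i z ↔
      ∃ x y : Site 2, x i = (N : ℤ) * v i ∧ y i = (N : ℤ) * v i + (N : ℤ) ∧
        PathIn (zdGraph 2) ({w : Site 2 | ∀ l : Fin 2, (N : ℤ) * v l ≤ w l ∧ w l ≤ (N : ℤ) * v l + (N : ℤ)} ∩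
          S) x y ∧ PathIn (zdGraph 2) S z x :=
    ⟨_, fun _ _ _ => Iff.rfl⟩
  -- every open coarse edge certifies both squares in both directions from one point
  have hedge : ∀ u v : Site 2, (openGraph {e : Sym2 (Site 2) | ∃ (a : Site 2) (k : Fin 2),
      e = s(a, a + Pi.single k 1) ∧ G₁ a k ∧ G₂ a k}).Adj u v →
      ∃ z, (∀ i, Cross u i z) ∧ ∀ i, Cross v i z := by
    intro u v huv
    rw [openGraph_adj] at huv
    obtain ⟨⟨a, k, hak, h1, h2⟩, -⟩ := huv
    obtain ⟨z, hz⟩ := hSq a k hN h1 h2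
    have hu : u = a ∨ u = a + Pi.single k 1 :=
      Sym2.mem_iff.1 (by rw [← hak]; exact Sym2.mem_mk_left u v)
    have hv : v = a ∨ v = a + Pi.single k 1 :=
      Sym2.mem_iff.1 (by rw [← hak]; exact Sym2.mem_mk_right u v)
    exact ⟨z, fun i => (hCross u i z).2 (hz u hu i), fun i => (hCross v i z).2 (hz v hv i)⟩
  -- the meet lemma in the square of `u`
  have hmeet : ∀ u z z', Cross u 0 z → Cross u 1 z' → PathIn (zdGraph 2) S z z' := by
    intro u z z' h h'
    obtain ⟨x, y, hx, hy, hP, hzx⟩ := (hCross u 0 z).1 h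
    obtain ⟨x', y', hx', hy', hQ, hzx'⟩ := (hCross u 1 z').1 h'
    have hm := pathIn_of_crossings hP hQ hx hy hx' hy'
      (fun w hw => ⟨(hw.1 0).1, (hw.1 0).2, (hw.1 1).1, (hw.1 1).2⟩)
    exact (hzx.trans (hm.mono inter_subset_right)).trans hzx'.symm
  -- re-basing a certificate along a path of `S`
  have htrans : ∀ v i z z', PathIn (zdGraph 2) S z z' → Cross v i z' → Cross v i z := by
    intro v i z z' hzz' h
    obtain ⟨x, y, hx, hy, hP, hz'x⟩ := (hCross v i z').1 h
    exact (hCross v i z).2 ⟨x, y, hx, hy, hP, hzz'.trans hz'x⟩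
  -- a base point: the infinite cluster has an edge at the origin
  obtain ⟨a, ha, ha0⟩ := hinf.exists_notMem_finset {0}
  obtain ⟨z₀, h0⟩ : ∃ z₀, ∀ i, Cross 0 i z₀ := by
    have hr : (openGraph {e : Sym2 (Site 2) | ∃ (a : Site 2) (k : Fin 2),
        e = s(a, a + Pi.single k 1) ∧ G₁ a k ∧ G₂ a k}).Reachable 0 a := ha
    rw [SimpleGraph.reachable_iff_reflTransGen] at hr
    rcases hr.cases_head with h | ⟨c, h0c, -⟩
    · exact absurd (Finset.mem_singleton.2 h.symm) ha0
    · obtain ⟨z, hz0, -⟩ := hedge 0 c h0c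
      exact ⟨z, hz0⟩
  -- every coarse vertex of the cluster is certified from `z₀`
  have hclaim : ∀ v ∈ openCluster {e : Sym2 (Site 2) | ∃ (a : Site 2) (k : Fin 2),
      e = s(a, a + Pi.single k 1) ∧ G₁ a k ∧ G₂ a k} (0 : Site 2), ∀ i, Cross v i z₀ :=
    fun v hv => cross_of_reachable hmeet htrans hedge h0 hv
  -- infinitely many planar sites joined to `z₀` through `S`
  have hT : {x : Site 2 | PathIn (zdGraph 2) S z₀ x}.Infinite := by
    intro hT
    apply hinf
    refine (hT.biUnion fun x _ => finite_fibre hN x).subset fun v hv => ?_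
    obtain ⟨x, y, -, -, hP, hzx⟩ := (hCross v 0 z₀).1 (hclaim v hv 0)
    exact mem_biUnion hzx hP.left_mem.1
  -- lift to `ℤ³`
  refine ⟨planeEmb 3 z₀, (hT.image (planeEmb_injective (by norm_num)).injOn).mono ?_⟩
  rintro _ ⟨x, hx, rfl⟩
  exact reachable_finiteClusters_of_pathIn hω (DCT16.pathIn_map (planeEmb 3) (fun a ha => ha)
    (fun a b _ _ h => planeEmb_adj (by norm_num) h) hx)

end CoarseToVacant

/-- **Registered stub `stub_coarseToVacant` (gluing).** Given the square-crossing certificate of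
every open coarse edge (the statement of `stub_squareCrossings`), an infinite open cluster of the
coarse origin in the renormalised bond process `BC n N ω` on `ℤ²` (`N ≥ 1`, `ω ⊆ E(ℤ³)`) gives an
infinite connected component of GHK's graph `X = ℤ³[{C finite}]`, i.e.
`ω ∈ finiteClustersPercolate (zdGraph 3)`.
[cite: GrimmettHolroydKozma2014, §4 (proof of Thm. 5, "there exists an infinite component in Γ")] -/
theorem stub_coarseToVacant :
    (∀ (n N : ℕ) (ω : BondConfig (Site 3)) (a : Site 2) (k : Fin 2), 1 ≤ N →
      (∃ x y : Site 2, x k = (N : ℤ) * a k ∧ y k = (N : ℤ) * a k + 2 * (N : ℤ) ∧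
        PathIn (zdGraph 2) ({w : Site 2 | ((N : ℤ) * a k ≤ w k ∧ w k ≤ (N : ℤ) * a k + 2 * (N : ℤ)) ∧
          ∀ j : Fin 2, j ≠ k → (N : ℤ) * a j ≤ w j ∧ w j ≤ (N : ℤ) * a j + (N : ℤ)} ∩
          {w | planeEmb 3 w ∈ quietSet n ω}) x y) →
      (∀ j : Fin 2, j ≠ k →
        (∃ x y : Site 2, x j = (N : ℤ) * a j ∧ y j = (N : ℤ) * a j + 2 * (N : ℤ) ∧
          PathIn (zdGraph 2) ({w : Site 2 | ((N : ℤ) * a j ≤ w j ∧ w j ≤ (N : ℤ) * a j + 2 * (N : ℤ)) ∧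
            ∀ i : Fin 2, i ≠ j → (N : ℤ) * a i ≤ w i ∧ w i ≤ (N : ℤ) * a i + (N : ℤ)} ∩
            {w | planeEmb 3 w ∈ quietSet n ω}) x y) ∧
        (∃ x y : Site 2, x j = (N : ℤ) * (a + Pi.single k 1 : Site 2) j ∧ y j = (N : ℤ) * (a + Pi.single k 1 : Site 2) j + 2 * (N : ℤ) ∧
          PathIn (zdGraph 2) ({w : Site 2 | ((N : ℤ) * (a + Pi.single k 1 : Site 2) j ≤ w j ∧ w j ≤ (N : ℤ) * (a + Pi.single k 1 : Site 2) j + 2 * (N : ℤ)) ∧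
            ∀ i : Fin 2, i ≠ j → (N : ℤ) * (a + Pi.single k 1 : Site 2) i ≤ w i ∧ w i ≤ (N : ℤ) * (a + Pi.single k 1 : Site 2) i + (N : ℤ)} ∩
            {w | planeEmb 3 w ∈ quietSet n ω}) x y)) →
      ∃ z : Site 2, ∀ v : Site 2, (v = a ∨ v = a + Pi.single k 1) → ∀ i : Fin 2,
        ∃ x y : Site 2, x i = (N : ℤ) * v i ∧ y i = (N : ℤ) * v i + (N : ℤ) ∧
          PathIn (zdGraph 2) ({w : Site 2 | ∀ l : Fin 2, (N : ℤ) * v l ≤ w l ∧ w l ≤ (N : ℤ) * v l + (N : ℤ)} ∩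
            {w | planeEmb 3 w ∈ quietSet n ω}) x y ∧
          PathIn (zdGraph 2) {w | planeEmb 3 w ∈ quietSet n ω} z x) →
    ∀ (n N : ℕ) (ω : BondConfig (Site 3)), 1 ≤ N → ω ⊆ (zdGraph 3).edgeSet →
      (openCluster
          {e : Sym2 (Site 2) | ∃ (a : Site 2) (k : Fin 2), e = s(a, a + Pi.single k 1) ∧
            (∃ x y : Site 2, x k = (N : ℤ) * a k ∧ y k = (N : ℤ) * a k + 2 * (N : ℤ) ∧
              PathIn (zdGraph 2) ({w : Site 2 | ((N : ℤ) * a k ≤ w k ∧ w k ≤ (N : ℤ) * a k + 2 * (N : ℤ)) ∧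
                ∀ j : Fin 2, j ≠ k → (N : ℤ) * a j ≤ w j ∧ w j ≤ (N : ℤ) * a j + (N : ℤ)} ∩
                {w | planeEmb 3 w ∈ quietSet n ω}) x y) ∧
            ∀ j : Fin 2, j ≠ k →
              (∃ x y : Site 2, x j = (N : ℤ) * a j ∧ y j = (N : ℤ) * a j + 2 * (N : ℤ) ∧
                PathIn (zdGraph 2) ({w : Site 2 | ((N : ℤ) * a j ≤ w j ∧ w j ≤ (N : ℤ) * a j + 2 * (N : ℤ)) ∧
                  ∀ i : Fin 2, i ≠ j → (N : ℤ) * a i ≤ w i ∧ w i ≤ (N : ℤ) * a i + (N : ℤ)} ∩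
                  {w | planeEmb 3 w ∈ quietSet n ω}) x y) ∧
              (∃ x y : Site 2, x j = (N : ℤ) * (a + Pi.single k 1 : Site 2) j ∧ y j = (N : ℤ) * (a + Pi.single k 1 : Site 2) j + 2 * (N : ℤ) ∧
                PathIn (zdGraph 2) ({w : Site 2 | ((N : ℤ) * (a + Pi.single k 1 : Site 2) j ≤ w j ∧ w j ≤ (N : ℤ) * (a + Pi.single k 1 : Site 2) j + 2 * (N : ℤ)) ∧
                  ∀ i : Fin 2, i ≠ j → (N : ℤ) * (a + Pi.single k 1 : Site 2) i ≤ w i ∧ w i ≤ (N : ℤ) * (a + Pi.single k 1 : Site 2) i + (N : ℤ)} ∩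
                  {w | planeEmb 3 w ∈ quietSet n ω}) x y)}
          (0 : Site 2)).Infinite →
      ω ∈ finiteClustersPercolate (zdGraph 3) := by
  intro hSq n N ω
  exact CoarseToVacant.mem_finiteClustersPercolate_of_coarse (hSq n N ω)

end Summit.CriticalPhenomena.PercolationContinuityZ3.Theorems
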